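import Summits.CriticalPhenomena.PercolationContinuityZ3.Theorems.PercNearOneGluingNoHeavyLowerTailSahiCombShapeCheck

/-!
# The comb (tensor-Bernstein) hierarchy for Sahi's `E_k`, XII: KERNEL CELL of the typed shape laws — COMB-ORDER1(3) = COMB-UNI(3) and
# COMB-ENDMIN(3) hold for every triple of increasing events of `{0,1}^2` (kernel `decide`)

Support file of the one-cut programme (crux `NoHeavyLowerTail`, stmt-CriticalPhenomena-4575; cell `prim-masterthm`, seat P5).
First in-kernel evidence for the shape conjectures of `…SahiCombShape` (census outside the kernel: P5 report §7.4, ≈ `2.4·10¹⁰` lines incl.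
`E_4` on `m = 4` and `E_5` on `m = 4` EXHAUSTIVE, `0` violations): the digit scan `SahiComb.checkShapeCube` of `…SahiCombShapeCheck` passes on
the cell `(n, m) = (3, 2)` — all `6³ = 216` ordered triples of increasing bitmasks of the square, digit base `2^10` (`coefBound 2 3 = 384 < 2^9`)
— by kernel evaluation (`decide +kernel`), and `shape_of_checkShapeCube` turns it into the laws:

* `checkShapeCube_three_two` — the scan passes;
* **`combShape_three_fin_two`** — for every triple `U` of increasing events of `2^{Fin 2}`, every axis `e` and profile `j`, the three-copy
  coefficient line `t ↦ combLine 3 U e j t` satisfies ENDMIN (`min(c_0,c_3) ≤ c_t`), ORDER-1 (`c_0 ≤ c_1`, `c_3 ≤ c_2`) and UNI.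
Larger cells (`(3,3)`, `(4,2)`, `(5,2)`, compiled evaluation) are in the computational companion `…SahiCombShapeCellsNative`.
No `sorry`, no `native_decide`; axioms standard. [this work]
-/

namespace Summit.CriticalPhenomena.PercolationContinuityZ3.Theorems

open SahiComb SahiC3Cube NCopyCert OneCutCert

/-- **The shape scan passes on `(n, m) = (3, 2)`** (216 ordered triples of increasing bitmasks of `{0,1}^2`, base `2^10`), kernel evaluation.
[this work] -/
theorem SahiComb.checkShapeCube_three_two :
    checkShapeCube 10 2 3 (fun T => (krTB 10 4 2 T : ℤ)) (krTB 10 4 2 (fullN 2)) (maskN 10 (4 ^ 2)) = true := by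
  decide +kernel

/-- **KERNEL CELL: ENDMIN(3), ORDER-1(3), UNI(3) on the square.**  For every triple of increasing events of `2^{Fin 2}`, every axis and
every profile, the three-copy comb coefficient line satisfies the three typed shape laws of `…SahiCombShape`. [this work] -/
theorem combShape_three_fin_two (U : Fin 3 → Set (Set (Fin 2))) (hU : ∀ i, IsUpperSet (U i)) (e : Fin 2) (j : Fin 2 → ℕ) :
    (∀ t, t ≤ 3 → min (combLine 3 U e j 0) (combLine 3 U e j 3) ≤ combLine 3 U e j t) ∧
      (combLine 3 U e j 0 ≤ combLine 3 U e j 1 ∧ combLine 3 U e j 3 ≤ combLine 3 U e j (3 - 1)) ∧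
      ∃ mo, mo ≤ 3 ∧ MonotoneOn (combLine 3 U e j) (Set.Icc 0 mo) ∧ AntitoneOn (combLine 3 U e j) (Set.Icc mo 3) :=
  shape_of_checkShapeCube (σ := 10) (by norm_num) (by decide) (fun _ => rfl) checkShapeCube_three_two (by norm_num) U hU e j

end Summit.CriticalPhenomena.PercolationContinuityZ3.Theorems
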